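import Summits.CriticalPhenomena.SAWScalingLimit.Theorems.SAWDefectDecoherenceObservableToSLERGateTransferLoops
import Literature.Topology.PlaneTopology.Janiszewski
import HarnessLib

/-!
# The limit bulk domain has uniformly locally connected complement along its boundary
# (piece (M3b) of stub 5a4″ `stub_carvedReduction_squeezeSolid`)

Piece of stub 5a4″ `stub_carvedReduction_squeezeSolid`
(`TwoPieceAdmRestrictionLimit → MovingCarvingSqueezeP FatAnchoredClassZeroSolid`) of the line
`bridge-gate-renewal` (r10) of the crux `SAWDefectDecoherence.ObservableToSLER`
(stmt-CriticalPhenomena-14005; twin T-A `stub_carvedReduction_squeezeGeometry` of stmt-CriticalPhenomena-10472),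
clause (C2) (the boundary LOOP of the inner domain `M + τ` is `η`-close to that of `D`).  The inner
domain is built in the conformal coordinates of the LIMIT BULK `Ω*` — the window component of
`(D - τ) ∖ Σ`, `Σ` the finite union of the limit carving hexagons — and its boundary loop is
tracked against `D.boundary` through the CONTINUOUS EXTENSION of a uniformizer `ψ : ℍ → Ω*` to
the closed half-plane.  `Ω*` is not a Jordan domain (pinches, slits), but Carathéodory's
continuity theorem only needs the uniform-continuum form of "`ℂ ∖ Ω*` is locally connected along
`∂Ω*`" (`Literature…CaratheodoryLC.continuousOn_extendFrom_of_lc`, hypothesis `hlc`), and that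
is what this file proves, in the generality "the frontier is covered by finitely many compact
pieces of the complement, each with the uniform-continuum property":

* `stub_carvedReduction_boundaryLC` — if `frontier G ⊆ ⋃ k, C k` with `C k ⊆ Gᶜ` compact and
  each `C k` has the uniform-continuum property (nearby points of `C k` lie in a small
  continuum inside `C k`), then `G` satisfies `hlc` (two nearby frontier points in different
  pieces are both close to a COMMON point of the two pieces — a compactness argument — and the
  two small continua through it are glued);
* `uniformContinuum_frontier` — the frontier of a Jordan domain has the property (short arcs,
  `BridgeGate.exists_short_arc`); `uniformContinuum_of_convex` — so does a compact convex set;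
* `boundaryLC_component` — hence every connected component of a Jordan domain minus finitely
  many compact convex sets (the limit bulk) satisfies `hlc`.

Sources: Ch. Pommerenke, Boundary Behaviour of Conformal Maps (1992) §2.2 (1), Thm. 2.1.
-/

noncomputable section
open scoped Topology
open Filter Set Metric
open Literature.Probability.RandomPlanarGeometry

namespace Summit.CriticalPhenomena.SAWScalingLimit.Theorems.ObservableToSLER.Squeeze

open Summit.CriticalPhenomena.SAWScalingLimit.Theorems.ObservableToSLER.BridgeGate (exists_short_arc)

/-! ### Two nearby points of two compact pieces are close to a common point -/

/-- For compact `C`, `C'` and `θ > 0` there is `δ > 0` such that any `a ∈ C`, `b ∈ C'` at distance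
`< δ` are BOTH within `θ` of some point of `C ∩ C'` (if `C ∩ C' = ∅` the conclusion says the two
pieces are `δ`-apart). -/
theorem exists_common_point_near {C C' : Set ℂ} (hC : IsCompact C) (hC' : IsCompact C') {θ : ℝ}
    (hθ : 0 < θ) :
    ∃ δ > (0 : ℝ), ∀ a ∈ C, ∀ b ∈ C', dist a b < δ → ∃ c ∈ C ∩ C', dist a c < θ ∧ dist b c < θ := by
  classical
  set P : Set (ℂ × ℂ) := (C ×ˢ C') ∩ ⋂ c ∈ C ∩ C', {p : ℂ × ℂ | θ ≤ dist p.1 c ∨ θ ≤ dist p.2 c}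
    with hP
  have hPc : IsCompact P := by
    refine (hC.prod hC').inter_right (isClosed_biInter fun c _ => ?_)
    exact (isClosed_le continuous_const (continuous_fst.dist continuous_const)).union
      (isClosed_le continuous_const (continuous_snd.dist continuous_const))
  have hpos : ∀ p ∈ P, 0 < dist p.1 p.2 := by
    rintro ⟨a, b⟩ ⟨⟨ha, hb⟩, hfar⟩
    refine dist_pos.2 fun hab => ?_
    simp only at ha hb hab
    have h := (mem_iInter₂.1 hfar) a ⟨ha, hab ▸ hb⟩
    subst hab
    simp only [mem_setOf_eq, dist_self] at h
    rcases h with h | h <;> linarith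
  by_cases hPne : P.Nonempty
  · obtain ⟨p₀, hp₀, hmin⟩ := hPc.exists_isMinOn hPne (continuous_fst.dist continuous_snd).continuousOn
    refine ⟨dist p₀.1 p₀.2, hpos p₀ hp₀, fun a ha b hb hab => ?_⟩
    by_contra hno
    push Not at hno
    have hmem : (a, b) ∈ P := by
      refine ⟨⟨ha, hb⟩, mem_iInter₂.2 fun c hc => ?_⟩
      by_cases h1 : dist a c < θ
      · exact Or.inr (hno c hc h1)
      · exact Or.inl (not_lt.1 h1)
    have := hmin hmem
    simp only [mem_setOf_eq] at this
    linarith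
  · refine ⟨1, one_pos, fun a ha b hb _ => ?_⟩
    by_contra hno
    push Not at hno
    refine hPne ⟨(a, b), ⟨ha, hb⟩, mem_iInter₂.2 fun c hc => ?_⟩
    by_cases h1 : dist a c < θ
    · exact Or.inr (hno c hc h1)
    · exact Or.inl (not_lt.1 h1)

/-! ### Gluing the pieces -/

/-- **Registered sub-goal `stub_carvedReduction_boundaryLC`** (crux item stmt-CriticalPhenomena-14005,
stub 5a4″ `stub_carvedReduction_squeezeSolid`, piece (M3b) UNIFORM LOCAL CONNECTIVITY OF THE
COMPLEMENT FROM FINITELY MANY PIECES): if the frontier of `G` is covered by finitely many compact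
sets `C k ⊆ Gᶜ` each with the uniform-continuum property, then any two nearby frontier points of
`G` lie in a small continuum inside `Gᶜ` (hypothesis `hlc` of Carathéodory's continuity theorem,
`continuousOn_extendFrom_of_lc`). [cite: PommerenkeBBCM1992, §2.2 (1), Thm. 2.1] -/
theorem stub_carvedReduction_boundaryLC :
    ∀ (G : Set ℂ) (m : ℕ) (C : Fin m → Set ℂ), frontier G ⊆ (⋃ k, C k) → (∀ k, C k ⊆ Gᶜ) →
      (∀ k, IsCompact (C k)) →
      (∀ k, ∀ ε > (0 : ℝ), ∃ δ > (0 : ℝ), ∀ a ∈ C k, ∀ b ∈ C k, dist a b < δ →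
        ∃ σ ⊆ C k, IsCompact σ ∧ IsPreconnected σ ∧ a ∈ σ ∧ b ∈ σ ∧ σ ⊆ closedBall a ε) →
      ∀ ε > (0 : ℝ), ∃ δ > (0 : ℝ), ∀ a ∈ frontier G, ∀ b ∈ frontier G, dist a b < δ →
        ∃ σ ⊆ Gᶜ, IsCompact σ ∧ IsPreconnected σ ∧ a ∈ σ ∧ b ∈ σ ∧ σ ⊆ closedBall a ε := by
  intro G m C hcov hCG hCc hC ε hε
  classical
  -- per-piece radii at scale `ε / 2`
  choose δ₁ hδ₁ hσ using fun k => hC k (ε / 2) (half_pos hε)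
  -- per-pair radii: nearby points of `C k`, `C l` are both `θ`-close to a common point
  have hθ : ∀ k l, 0 < min (δ₁ k) (δ₁ l) := fun k l => lt_min (hδ₁ k) (hδ₁ l)
  choose δ₂ hδ₂ hcommon using fun kl : Fin m × Fin m =>
    exists_common_point_near (hCc kl.1) (hCc kl.2) (hθ kl.1 kl.2)
  -- a common radius
  obtain ⟨δ, hδ, hδle⟩ : ∃ δ > (0 : ℝ), ∀ kl, δ ≤ δ₂ kl := by
    by_cases hm : Nonempty (Fin m × Fin m)
    · obtain ⟨kl₀, h₀⟩ := Finite.exists_min δ₂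
      exact ⟨δ₂ kl₀, hδ₂ kl₀, h₀⟩
    · exact ⟨1, one_pos, fun kl => (hm ⟨kl⟩).elim⟩
  refine ⟨δ, hδ, fun a ha b hb hab => ?_⟩
  obtain ⟨k, hak⟩ := mem_iUnion.1 (hcov ha)
  obtain ⟨l, hbl⟩ := mem_iUnion.1 (hcov hb)
  obtain ⟨c, ⟨hck, hcl⟩, hac, hbc⟩ := hcommon (k, l) a hak b hbl (hab.trans_le (hδle (k, l)))
  obtain ⟨σ₁, hσ₁C, hσ₁c, hσ₁p, haσ₁, hcσ₁, hσ₁ball⟩ :=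
    hσ k a hak c hck (hac.trans_le (min_le_left _ _))
  obtain ⟨σ₂, hσ₂C, hσ₂c, hσ₂p, hcσ₂, hbσ₂, hσ₂ball⟩ :=
    hσ l c hcl b hbl (by rw [dist_comm]; exact hbc.trans_le (min_le_right _ _))
  refine ⟨σ₁ ∪ σ₂, union_subset (hσ₁C.trans (hCG k)) (hσ₂C.trans (hCG l)), hσ₁c.union hσ₂c,
    hσ₁p.union c hcσ₁ hcσ₂ hσ₂p, Or.inl haσ₁, Or.inr hbσ₂, ?_⟩
  have hca : dist c a ≤ ε / 2 := mem_closedBall.1 (hσ₁ball hcσ₁)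
  rintro z (hz | hz)
  · exact mem_closedBall.2 ((mem_closedBall.1 (hσ₁ball hz)).trans (by linarith))
  · have hzc : dist z c ≤ ε / 2 := mem_closedBall.1 (hσ₂ball hz)
    exact mem_closedBall.2 ((dist_triangle z c a).trans (by linarith))

/-! ### The pieces: the frontier of a Jordan domain, compact convex sets -/

/-- **Short arcs**: the frontier of a Jordan domain has the uniform-continuum property — two
nearby boundary points lie on a sub-arc of the boundary loop staying close to the first. -/
theorem uniformContinuum_frontier (D : JordanDomain) :
    ∀ ε > (0 : ℝ), ∃ δ > (0 : ℝ), ∀ a ∈ frontier D.carrier, ∀ b ∈ frontier D.carrier, dist a b < δ →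
      ∃ σ ⊆ frontier D.carrier, IsCompact σ ∧ IsPreconnected σ ∧ a ∈ σ ∧ b ∈ σ ∧
        σ ⊆ closedBall a ε := by
  intro ε hε
  obtain ⟨lam, hlam, hshort⟩ := exists_short_arc D hε
  refine ⟨lam, hlam, fun a ha b hb hab => ?_⟩
  rw [← D.range_boundary] at ha hb
  obtain ⟨s, rfl⟩ := ha
  obtain ⟨t', rfl⟩ := hb
  obtain ⟨t, ht, htt'⟩ := D.periodic_boundary.exists_mem_Ico one_pos t' s
  rw [htt'] at hab ⊢
  have harc : ∀ x y : ℝ, x ≤ y → IsCompact (D.boundary '' Icc x y) ∧ IsPreconnected (D.boundary '' Icc x y) ∧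
      D.boundary '' Icc x y ⊆ frontier D.carrier := fun x y hxy =>
    ⟨isCompact_Icc.image D.continuous_boundary,
      (isPreconnected_Icc).image _ D.continuous_boundary.continuousOn,
      by rw [← D.range_boundary]; exact image_subset_range _ _⟩
  rcases ht.1.eq_or_lt with h | hst
  · -- `a = b`
    subst h
    refine ⟨{D.boundary s}, ?_, isCompact_singleton, isPreconnected_singleton, rfl, rfl, ?_⟩
    · rw [singleton_subset_iff, ← D.range_boundary]; exact mem_range_self _
    · rw [singleton_subset_iff]; exact mem_closedBall_self hε.le
  rcases hshort s t hst ht.2 hab with h | h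
  · obtain ⟨hc, hp, hsub⟩ := harc s t hst.le
    refine ⟨D.boundary '' Icc s t, hsub, hc, hp, ⟨s, left_mem_Icc.2 hst.le, rfl⟩,
      ⟨t, right_mem_Icc.2 hst.le, rfl⟩, ?_⟩
    rintro _ ⟨u, hu, rfl⟩
    exact mem_closedBall.2 (h u hu).le
  · obtain ⟨hc, hp, hsub⟩ := harc t (s + 1) ht.2.le
    refine ⟨D.boundary '' Icc t (s + 1), hsub, hc, hp, ⟨s + 1, right_mem_Icc.2 ht.2.le, ?_⟩,
      ⟨t, left_mem_Icc.2 ht.2.le, rfl⟩, ?_⟩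
    · exact D.periodic_boundary s
    · rintro _ ⟨u, hu, rfl⟩
      exact mem_closedBall.2 (h u hu).le

/-- A compact convex set has the uniform-continuum property (segments). -/
theorem uniformContinuum_of_convex {K : Set ℂ} (hK : Convex ℝ K) :
    ∀ ε > (0 : ℝ), ∃ δ > (0 : ℝ), ∀ a ∈ K, ∀ b ∈ K, dist a b < δ →
      ∃ σ ⊆ K, IsCompact σ ∧ IsPreconnected σ ∧ a ∈ σ ∧ b ∈ σ ∧ σ ⊆ closedBall a ε := by
  intro ε hε
  refine ⟨ε, hε, fun a ha b hb hab => ⟨segment ℝ a b, hK.segment_subset ha hb, ?_,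
    (convex_segment a b).isPreconnected, left_mem_segment ℝ a b, right_mem_segment ℝ a b, ?_⟩⟩
  · rw [segment_eq_image]
    exact isCompact_Icc.image (by fun_prop)
  · exact (convex_closedBall a ε).segment_subset (mem_closedBall_self hε.le)
      (mem_closedBall.2 (by rw [dist_comm]; exact hab.le))

/-! ### The limit bulk: a component of a Jordan domain minus finitely many convex compacta -/

/-- **The limit bulk satisfies `hlc`.**  Let `D` be a Jordan domain, `K k` (`k : Fin m`) compact
convex sets, and `G` a connected component of `D ∖ ⋃ k, K k` (in the squeeze: the window
component of `D - τ` minus the limit carving hexagons).  Then any two nearby frontier points of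
`G` lie in a small continuum inside `Gᶜ` — the hypothesis `hlc` of
`ConformalEquiv.continuousOn_extendFrom_of_lc`, so uniformizers of `G` extend continuously to the
closed disc / half-plane. -/
theorem boundaryLC_component (D : JordanDomain) {m : ℕ} (K : Fin m → Set ℂ)
    (hKc : ∀ k, IsCompact (K k)) (hKconv : ∀ k, Convex ℝ (K k)) (x : ℂ) :
    ∀ ε > (0 : ℝ), ∃ δ > (0 : ℝ),
      ∀ a ∈ frontier (connectedComponentIn (D.carrier \ ⋃ k, K k) x),
      ∀ b ∈ frontier (connectedComponentIn (D.carrier \ ⋃ k, K k) x), dist a b < δ →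
        ∃ σ ⊆ (connectedComponentIn (D.carrier \ ⋃ k, K k) x)ᶜ, IsCompact σ ∧ IsPreconnected σ ∧
          a ∈ σ ∧ b ∈ σ ∧ σ ⊆ closedBall a ε := by
  classical
  set F : Set ℂ := D.carrier \ ⋃ k, K k with hF
  set G : Set ℂ := connectedComponentIn F x with hG
  -- the pieces: `C 0 = frontier D`, `C (k+1) = K k`
  set C : Fin (m + 1) → Set ℂ := Fin.cases (frontier D.carrier) K with hC
  have hC0 : C 0 = frontier D.carrier := rfl
  have hCs : ∀ k : Fin m, C k.succ = K k := fun k => rfl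
  have hGF : G ⊆ F := connectedComponentIn_subset _ _
  -- the frontier of a component of `F = (Dᶜ ∪ ⋃ K)ᶜ` lies in `frontier D ∪ ⋃ K`
  have hclosed : IsClosed (D.carrierᶜ ∪ ⋃ k, K k) :=
    D.isOpen.isClosed_compl.union (isClosed_iUnion_of_finite fun k => (hKc k).isClosed)
  have hFeq : F = (D.carrierᶜ ∪ ⋃ k, K k)ᶜ := by
    rw [hF, compl_union, compl_compl, Set.sdiff_eq]
  have hfront : frontier G ⊆ ⋃ k, C k := by
    intro z hz
    have hz1 : z ∈ D.carrierᶜ ∪ ⋃ k, K k := by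
      have := Literature.Topology.PlaneTopology.Janiszewski.frontier_connectedComponentIn_subset hclosed x
      rw [← hFeq] at this
      exact this hz
    rcases hz1 with hzD | hzK
    · have hzcl : z ∈ closure D.carrier :=
        closure_mono (hGF.trans Set.sdiff_subset) (frontier_subset_closure hz)
      refine mem_iUnion.2 ⟨0, ?_⟩
      rw [hC0, frontier_eq_closure_inter_closure, closure_compl, D.isOpen.interior_eq]
      exact ⟨hzcl, hzD⟩
    · obtain ⟨k, hk⟩ := mem_iUnion.1 hzK
      exact mem_iUnion.2 ⟨k.succ, by rw [hCs]; exact hk⟩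
  have hCG : ∀ k, C k ⊆ Gᶜ := by
    refine Fin.cases ?_ (fun k => ?_)
    · intro z hz hzG
      rw [hC0, D.isOpen.frontier_eq] at hz
      exact hz.2 (hGF hzG).1
    · intro z hz hzG
      rw [hCs] at hz
      exact (hGF hzG).2 (mem_iUnion.2 ⟨k, hz⟩)
  have hCc : ∀ k, IsCompact (C k) := by
    refine Fin.cases ?_ (fun k => by rw [hCs]; exact hKc k)
    rw [hC0]
    exact D.isBounded.isCompact_closure.of_isClosed_subset isClosed_frontier frontier_subset_closure
  have hCu : ∀ k, ∀ ε > (0 : ℝ), ∃ δ > (0 : ℝ), ∀ a ∈ C k, ∀ b ∈ C k, dist a b < δ →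
      ∃ σ ⊆ C k, IsCompact σ ∧ IsPreconnected σ ∧ a ∈ σ ∧ b ∈ σ ∧ σ ⊆ closedBall a ε := by
    refine Fin.cases ?_ (fun k => by rw [hCs]; exact uniformContinuum_of_convex (hKconv k))
    rw [hC0]
    exact uniformContinuum_frontier D
  exact stub_carvedReduction_boundaryLC G (m + 1) C hfront hCG hCc hCu

end Summit.CriticalPhenomena.SAWScalingLimit.Theorems.ObservableToSLER.Squeeze

end
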